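import Summits.QuantumFields.BalabanUV.Beta.GAN24.SymbolTaylor

/-!
# `BalabanUV.Beta.GAN24.SymbolProjector` — binder row G-an2-4 / (CONV-C), road P1-fibre, leaf P1-L07 (node N15 `symbol_taylor`, step B1 of
# `SKELETON-P1.md`), companion of `GAN24/SymbolTaylor.lean`: the TRANSVERSE PROJECTOR in the symbol — scale invariance, the entrywise
# Lipschitz bound, and its `O(|q|²/N²)` rate at fine momentum `q/N`

NOT IN PRINT; OUR PROOF ATTEMPT.  HONEST FRAMING (cell contract, verbatim): «discharging `BetaPertH` makes Bałaban's UV stability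
UNCONDITIONAL — a real constructive-QFT result; it is NOT the continuum limit and NOT the Clay problem.»  HONEST DEPENDENCY (verbatim):
«continuum YM on T⁴ ⇐ BetaPertH ∧ nine spine estimates (0/9 proved); BetaPertH ⇐ (D1) ∧ (D4) ∧ CAP+tail; G-an2-4 gates asym, D1 and
NE2/3/4.»  [folklore] finite-dimensional real analysis (Cauchy–Schwarz, reverse triangle inequality); no cited fact, no wall binder, no numerical
constant beyond the exact rationals `4`, `1/24`, `1/6`.  NOT summit progress; a leaf of road P1 toward the binder K-slot `GAN24.CombesThomas.ConvCK 3 Lc` only.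

## What is proved (index type `ι` finite; `|u|² = King1986.momSq u = Σ_κ u_κ²`; `P(u)_{κl} := u_κ u_l/|u|²`, so `Π⊥(u) = 1 − P(u)`; Lean's `x/0 = 0` makes `P(0) = 0`)
* `abs_apply_le_sqrt_momSq`, `abs_div_sqrt_momSq_le_one`, `sum_mul_le_sqrt_momSq_mul` (Cauchy–Schwarz), `momSq_sub`,
  `abs_sqrt_momSq_sub_sqrt_momSq_le` (reverse triangle inequality);
* `abs_unit_sub_unit_le`: `|u_κ/|u| − v_κ/|v|| ≤ 2|u − v|/|v|` (`v ≠ 0`, ANY `u`);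
* `abs_proj_sub_proj_le`: **`|P(u)_{κl} − P(v)_{κl}| ≤ 4|u − v|/|v|`** (`v ≠ 0`, any `u`); `proj_smul`: `P(c·u) = P(u)` (`c ≠ 0`);
* `sqrt_momSq_sin_sub_le`: the lattice sine vector `u_κ = 2N sin(q_κ/(2N))` satisfies `|u − q| ≤ |q|³/(24N²)` (`N > 0`, all `q`);
* `abs_proj_sin_sub_proj_le` (′): **`|P(u)_{κl} − P(q)_{κl}| ≤ |q|²/(6N²)`** for `q ≠ 0`, every `N > 0`, NO Brillouin-zone hypothesis (also for the
  unscaled sine vector `2 sin(q_κ/(2N))` = the moduli `‖dhat(q/N)_κ‖`, by scale invariance);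
* `dhat_mul_dflat_div_lapSym_ofRealVec`: in the complex symbol at real `k`, `dhat_κ · dflat_l / lapSym = e^{i(k_κ − k_l)/2} · P(s)_{κl}`,
  `s_κ = 2 sin(k_κ/2)` — the lattice transverse projector is the diagonal-phase conjugate of a REAL rank-one projector.
This is the "transverse-projector Lipschitz bound in the symbol" of LEMMAS.md row P1-L07: after the phase conjugation (B1: "the first-order
terms are PHASES"), the transverse block `Π⊥_m/(2L_m)` of `T(k_m)⁻¹` at `N` and at `Lc·N` differ by `O(|p+2πm|²/N²) = O(Lc^{−2(j+1)})` — rate `θ = Lc⁻²`.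
-/

open Complex Finset
open scoped BigOperators Real

namespace Summit.QuantumFields.BalabanUV.Beta.GAN24.SymbolProjector

open Literature.MathematicalPhysics.QuantumFieldTheory.Balaban1983to89.B4Strip (ofRealVec)
open Literature.MathematicalPhysics.QuantumFieldTheory.King1986 (momSq momSq_nonneg)
open FibreSymbols (dhat dflat lapSym)
open SymbolTaylor (abs_two_mul_sin_sub_le dhat_mul_dflat_ofRealVec lapSym_ofRealVec_eq_momSq)

variable {D : ℕ}

/-! ## §4a Euclidean length `|u| = √(momSq u)` on `ι → ℝ` and the unit-vector / projector Lipschitz bounds -/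

section Projector

variable {ι : Type*} [Fintype ι]

/-- [folklore] `|u_κ| ≤ |u| = √(momSq u)`. -/
theorem abs_apply_le_sqrt_momSq (u : ι → ℝ) (κ : ι) : |u κ| ≤ Real.sqrt (momSq u) := by
  apply Real.abs_le_sqrt
  unfold momSq
  exact Finset.single_le_sum (fun l _ => sq_nonneg (u l)) (Finset.mem_univ κ)

/-- [folklore] Unit components are bounded by one: `|u_κ / |u|| ≤ 1` (also for `u = 0`). -/
theorem abs_div_sqrt_momSq_le_one (u : ι → ℝ) (κ : ι) : |u κ / Real.sqrt (momSq u)| ≤ 1 := by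
  rw [abs_div, abs_of_nonneg (Real.sqrt_nonneg _)]
  exact div_le_one_of_le₀ (abs_apply_le_sqrt_momSq u κ) (Real.sqrt_nonneg _)

/-- [folklore] Cauchy–Schwarz: `Σ_κ u_κ v_κ ≤ |u|·|v|`. -/
theorem sum_mul_le_sqrt_momSq_mul (u v : ι → ℝ) :
    ∑ κ, u κ * v κ ≤ Real.sqrt (momSq u) * Real.sqrt (momSq v) := by
  have hcs := Finset.sum_mul_sq_le_sq_mul_sq Finset.univ u v
  calc ∑ κ, u κ * v κ ≤ |∑ κ, u κ * v κ| := le_abs_self _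
    _ = Real.sqrt ((∑ κ, u κ * v κ) ^ 2) := (Real.sqrt_sq_eq_abs _).symm
    _ ≤ Real.sqrt (momSq u * momSq v) := Real.sqrt_le_sqrt (by unfold momSq; exact hcs)
    _ = Real.sqrt (momSq u) * Real.sqrt (momSq v) := Real.sqrt_mul (momSq_nonneg u) _

/-- [folklore] `|u − v|² = |u|² + |v|² − 2 Σ u_κ v_κ`. -/
theorem momSq_sub (u v : ι → ℝ) : momSq (u - v) = momSq u + momSq v - 2 * ∑ κ, u κ * v κ := by
  unfold momSq
  rw [Finset.mul_sum, ← Finset.sum_add_distrib, ← Finset.sum_sub_distrib]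
  exact Finset.sum_congr rfl fun κ _ => by simp only [Pi.sub_apply]; ring

/-- [folklore] Reverse triangle inequality for the Euclidean length: `||v| − |u|| ≤ |u − v|`. -/
theorem abs_sqrt_momSq_sub_sqrt_momSq_le (u v : ι → ℝ) :
    |Real.sqrt (momSq v) - Real.sqrt (momSq u)| ≤ Real.sqrt (momSq (u - v)) := by
  apply Real.abs_le_sqrt
  rw [momSq_sub, sub_sq, Real.sq_sqrt (momSq_nonneg v), Real.sq_sqrt (momSq_nonneg u)]
  have := sum_mul_le_sqrt_momSq_mul u v
  nlinarith

/-- [folklore] **Unit-vector Lipschitz bound**: `|u_κ/|u| − v_κ/|v|| ≤ 2|u − v|/|v|` for `v ≠ 0` and ANY `u` (for `u = 0` the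
left side is `|v_κ|/|v| ≤ 1` and the right side is `2`). -/
theorem abs_unit_sub_unit_le (u : ι → ℝ) {v : ι → ℝ} (hv : 0 < momSq v) (κ : ι) :
    |u κ / Real.sqrt (momSq u) - v κ / Real.sqrt (momSq v)|
      ≤ 2 * Real.sqrt (momSq (u - v)) / Real.sqrt (momSq v) := by
  set U := Real.sqrt (momSq u) with hU
  set V := Real.sqrt (momSq v) with hV
  set E := Real.sqrt (momSq (u - v)) with hE
  have hVpos : 0 < V := Real.sqrt_pos.2 hv
  have hdiff : |u κ - v κ| ≤ E := by simpa using abs_apply_le_sqrt_momSq (u - v) κ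
  have hVU : |V - U| ≤ E := abs_sqrt_momSq_sub_sqrt_momSq_le u v
  rcases eq_or_lt_of_le (Real.sqrt_nonneg (momSq u)) with hU0 | hUpos
  · -- `u = 0`
    have hU0' : U = 0 := by rw [hU]; exact hU0.symm
    have hu0 : ∀ l, u l = 0 := by
      intro l
      have h := abs_apply_le_sqrt_momSq u l
      rw [← hU, hU0'] at h
      exact abs_nonpos_iff.1 h
    have hEV : E = V := by
      rw [hE, hV]; congr 1; unfold momSq
      exact Finset.sum_congr rfl fun l _ => by simp [hu0 l]
    rw [hU0', div_zero, zero_sub, abs_neg, hEV]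
    have h1 : |v κ / V| ≤ 1 := abs_div_sqrt_momSq_le_one v κ
    have h2 : 2 * V / V = 2 := by field_simp
    rw [h2]; linarith
  · -- `u ≠ 0`
    have hUne : U ≠ 0 := by rw [hU]; exact hUpos.ne'
    have hsplit : u κ / U - v κ / V = (u κ - v κ) / V + (u κ / U) * ((V - U) / V) := by
      field_simp; ring
    rw [hsplit]
    have hunit : |u κ / U| ≤ 1 := abs_div_sqrt_momSq_le_one u κ
    calc |(u κ - v κ) / V + u κ / U * ((V - U) / V)|
        ≤ |(u κ - v κ) / V| + |u κ / U * ((V - U) / V)| := abs_add_le _ _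
      _ = |u κ - v κ| / V + |u κ / U| * (|V - U| / V) := by
          rw [abs_div, abs_of_pos hVpos, abs_mul, abs_div (V - U), abs_of_pos hVpos]
      _ ≤ E / V + 1 * (E / V) := by
          refine add_le_add (div_le_div_of_nonneg_right hdiff hVpos.le) ?_
          exact mul_le_mul hunit (div_le_div_of_nonneg_right hVU hVpos.le) (by positivity) zero_le_one
      _ = 2 * E / V := by ring

/-- [folklore] `P(u)_{κl} = (u_κ/|u|)·(u_l/|u|)`. -/
theorem proj_eq_unit_mul_unit (u : ι → ℝ) (κ l : ι) :
    u κ * u l / momSq u = (u κ / Real.sqrt (momSq u)) * (u l / Real.sqrt (momSq u)) := by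
  rw [div_mul_div_comm, Real.mul_self_sqrt (momSq_nonneg u)]

/-- [folklore] **Transverse-projector Lipschitz bound (entrywise)**: `|P(u)_{κl} − P(v)_{κl}| ≤ 4|u − v|/|v|` for `v ≠ 0` and any `u`;
the same bound holds for `Π⊥ = 1 − P`. -/
theorem abs_proj_sub_proj_le (u : ι → ℝ) {v : ι → ℝ} (hv : 0 < momSq v) (κ l : ι) :
    |u κ * u l / momSq u - v κ * v l / momSq v| ≤ 4 * Real.sqrt (momSq (u - v)) / Real.sqrt (momSq v) := by
  rw [proj_eq_unit_mul_unit u, proj_eq_unit_mul_unit v]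
  set a := u κ / Real.sqrt (momSq u)
  set b := u l / Real.sqrt (momSq u)
  set c := v κ / Real.sqrt (momSq v)
  set d := v l / Real.sqrt (momSq v)
  have hb : |b| ≤ 1 := abs_div_sqrt_momSq_le_one u l
  have hc : |c| ≤ 1 := abs_div_sqrt_momSq_le_one v κ
  have h1 : |a - c| ≤ 2 * Real.sqrt (momSq (u - v)) / Real.sqrt (momSq v) := abs_unit_sub_unit_le u hv κ
  have h2 : |b - d| ≤ 2 * Real.sqrt (momSq (u - v)) / Real.sqrt (momSq v) := abs_unit_sub_unit_le u hv l
  calc |a * b - c * d| = |(a - c) * b + c * (b - d)| := by ring_nf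
    _ ≤ |(a - c) * b| + |c * (b - d)| := abs_add_le _ _
    _ = |a - c| * |b| + |c| * |b - d| := by rw [abs_mul, abs_mul]
    _ ≤ |a - c| * 1 + 1 * |b - d| :=
        add_le_add (mul_le_mul_of_nonneg_left hb (abs_nonneg _)) (mul_le_mul_of_nonneg_right hc (abs_nonneg _))
    _ ≤ 2 * Real.sqrt (momSq (u - v)) / Real.sqrt (momSq v) + 2 * Real.sqrt (momSq (u - v)) / Real.sqrt (momSq v) := by
        linarith
    _ = 4 * Real.sqrt (momSq (u - v)) / Real.sqrt (momSq v) := by ring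

/-- [folklore] `|c u|² = c² |u|²`. -/
theorem momSq_smul (c : ℝ) (u : ι → ℝ) : momSq (fun i => c * u i) = c ^ 2 * momSq u := by
  unfold momSq; rw [Finset.mul_sum]
  exact Finset.sum_congr rfl fun i _ => by ring

/-- [folklore] **Scale invariance** `P(c·u) = P(u)` for `c ≠ 0` (so the lattice projector built from `2 sin(k_κ/2)` equals the one
built from `2N sin(q_κ/(2N))`, `k = q/N`). -/
theorem proj_smul {c : ℝ} (hc : c ≠ 0) (u : ι → ℝ) (κ l : ι) :
    (c * u κ) * (c * u l) / momSq (fun i => c * u i) = u κ * u l / momSq u := by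
  rw [momSq_smul]
  rcases eq_or_ne (momSq u) 0 with h0 | h0
  · simp [h0]
  · field_simp

end Projector

/-! ## §4b The lattice sine vector at fine momentum `q/N` and the projector rate -/

/-- [folklore] `Σ_κ q_κ⁶ ≤ |q|⁶`. -/
theorem sum_pow_six_le (q : Fin D → ℝ) : ∑ i, q i ^ 6 ≤ momSq q ^ 3 := by
  unfold momSq
  have hle : ∀ i ∈ (Finset.univ : Finset (Fin D)), q i ^ 2 ≤ ∑ j, q j ^ 2 := fun i _ =>
    Finset.single_le_sum (fun j _ => sq_nonneg (q j)) (Finset.mem_univ i)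
  calc ∑ i, q i ^ 6 = ∑ i, q i ^ 2 * (q i ^ 2) ^ 2 := Finset.sum_congr rfl fun i _ => by ring
    _ ≤ ∑ i, q i ^ 2 * (∑ j, q j ^ 2) ^ 2 :=
        Finset.sum_le_sum fun i hi =>
          mul_le_mul_of_nonneg_left (pow_le_pow_left₀ (sq_nonneg _) (hle i hi) 2) (sq_nonneg _)
    _ = (∑ j, q j ^ 2) ^ 3 := by rw [← Finset.sum_mul]; ring

/-- [folklore] The lattice sine vector is `O(|q|³/N²)`-close to `q`: `|u − q| ≤ |q|³/(24N²)`, `u_κ = 2N sin(q_κ/(2N))` (`N > 0`). -/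
theorem sqrt_momSq_sin_sub_le {N : ℝ} (hN : 0 < N) (q : Fin D → ℝ) :
    Real.sqrt (momSq ((fun i => 2 * N * Real.sin (q i / (2 * N))) - q))
      ≤ Real.sqrt (momSq q) ^ 3 / (24 * N ^ 2) := by
  set V := Real.sqrt (momSq q) with hV
  have hpt : ∀ i, (2 * N * Real.sin (q i / (2 * N)) - q i) ^ 2 ≤ (|q i| ^ 3 / (24 * N ^ 2)) ^ 2 := by
    intro i
    have h := abs_two_mul_sin_sub_le hN (q i)
    calc (2 * N * Real.sin (q i / (2 * N)) - q i) ^ 2 = |2 * N * Real.sin (q i / (2 * N)) - q i| ^ 2 := (sq_abs _).symm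
      _ ≤ (|q i| ^ 3 / (24 * N ^ 2)) ^ 2 := pow_le_pow_left₀ (abs_nonneg _) h 2
  have h6 : ∑ i, (|q i| ^ 3 / (24 * N ^ 2)) ^ 2 = (∑ i, q i ^ 6) / (24 * N ^ 2) ^ 2 := by
    rw [Finset.sum_div]
    refine Finset.sum_congr rfl fun i _ => ?_
    rw [div_pow, ← pow_mul, Even.pow_abs (by decide : Even (3 * 2))]
  rw [Real.sqrt_le_iff]
  refine ⟨by positivity, ?_⟩
  have hV2 : momSq q = V ^ 2 := (Real.sq_sqrt (momSq_nonneg q)).symm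
  calc momSq ((fun i => 2 * N * Real.sin (q i / (2 * N))) - q)
      = ∑ i, (2 * N * Real.sin (q i / (2 * N)) - q i) ^ 2 := by unfold momSq; rfl
    _ ≤ ∑ i, (|q i| ^ 3 / (24 * N ^ 2)) ^ 2 := Finset.sum_le_sum fun i _ => hpt i
    _ = (∑ i, q i ^ 6) / (24 * N ^ 2) ^ 2 := h6
    _ ≤ momSq q ^ 3 / (24 * N ^ 2) ^ 2 := div_le_div_of_nonneg_right (sum_pow_six_le q) (by positivity)
    _ = (V ^ 3 / (24 * N ^ 2)) ^ 2 := by rw [hV2]; ring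

/-- [folklore] **Projector rate at fine momentum `q/N`**: with the lattice sine vector `u_κ = 2N sin(q_κ/(2N))` and `q ≠ 0`,
`|P(u)_{κl} − P(q)_{κl}| ≤ |q|²/(6N²)` for every `N > 0` (no zone hypothesis) — the `O(Lc^{−2(j+1)})` symbol input of Part B for the
transverse block `Π⊥/(2L)`. -/
theorem abs_proj_sin_sub_proj_le {N : ℝ} (hN : 0 < N) {q : Fin D → ℝ} (hq : 0 < momSq q) (κ l : Fin D) :
    |(2 * N * Real.sin (q κ / (2 * N))) * (2 * N * Real.sin (q l / (2 * N)))
          / momSq (fun i => 2 * N * Real.sin (q i / (2 * N))) - q κ * q l / momSq q|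
      ≤ momSq q / (6 * N ^ 2) := by
  set u : Fin D → ℝ := fun i => 2 * N * Real.sin (q i / (2 * N)) with hu
  set V := Real.sqrt (momSq q) with hV
  have hVpos : 0 < V := Real.sqrt_pos.2 hq
  have h := abs_proj_sub_proj_le u hq κ l
  have hE := sqrt_momSq_sin_sub_le hN q
  have hV2 : momSq q = V ^ 2 := (Real.sq_sqrt (momSq_nonneg q)).symm
  calc |u κ * u l / momSq u - q κ * q l / momSq q| ≤ 4 * Real.sqrt (momSq (u - q)) / V := h
    _ ≤ 4 * (V ^ 3 / (24 * N ^ 2)) / V := by gcongr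
    _ = V ^ 2 / (6 * N ^ 2) := by field_simp; ring
    _ = momSq q / (6 * N ^ 2) := by rw [hV2]

/-- [folklore] The same rate for the UNSCALED sine vector `s_κ = 2 sin(q_κ/(2N))` (the actual moduli `‖dhat(q/N)_κ‖`), by scale invariance. -/
theorem abs_proj_sin_sub_proj_le' {N : ℝ} (hN : 0 < N) {q : Fin D → ℝ} (hq : 0 < momSq q) (κ l : Fin D) :
    |(2 * Real.sin (q κ / (2 * N))) * (2 * Real.sin (q l / (2 * N)))
          / momSq (fun i => 2 * Real.sin (q i / (2 * N))) - q κ * q l / momSq q|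
      ≤ momSq q / (6 * N ^ 2) := by
  have h := abs_proj_sin_sub_proj_le hN hq κ l
  have hs := proj_smul hN.ne' (fun i => 2 * Real.sin (q i / (2 * N))) κ l
  have e : (fun i => N * (2 * Real.sin (q i / (2 * N)))) = fun i => 2 * N * Real.sin (q i / (2 * N)) := by
    funext i; ring
  rw [e] at hs
  rw [show N * (2 * Real.sin (q κ / (2 * N))) * (N * (2 * Real.sin (q l / (2 * N))))
      = 2 * N * Real.sin (q κ / (2 * N)) * (2 * N * Real.sin (q l / (2 * N))) by ring] at hs
  rw [← hs]; exact h

/-- [folklore] **`Π⊥` in the complex symbol**: at real momentum `k`, `dhat_κ · dflat_l / lapSym = e^{i(k_κ − k_l)/2} · P(s)_{κl}` with the sine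
vector `s_κ = 2 sin(k_κ/2)` (both sides are `0` when `lapSym = 0`): the lattice transverse projector is the diagonal-phase conjugate
`U P(s) U*`, `U = diag(e^{ik_κ/2})`, of a REAL projector. -/
theorem dhat_mul_dflat_div_lapSym_ofRealVec (k : Fin D → ℝ) (κ l : Fin D) :
    dhat (ofRealVec k) κ * dflat (ofRealVec k) l / lapSym (ofRealVec k)
      = cexp (I * ((k κ - k l) / 2 : ℝ)) *
          (((2 * Real.sin (k κ / 2)) * (2 * Real.sin (k l / 2)) / momSq (fun i => 2 * Real.sin (k i / 2)) : ℝ) : ℂ) := by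
  rw [dhat_mul_dflat_ofRealVec, lapSym_ofRealVec_eq_momSq, mul_div_assoc, ← Complex.ofReal_div]

end Summit.QuantumFields.BalabanUV.Beta.GAN24.SymbolProjector
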